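import Literature.Computability.AlgebraicComplexity.DDS21BorderBaseChange
import Mathlib.RingTheory.Localization.FractionRing
import HarnessLib

/-!
# Dutta–Dwivedi–Saxena 2021, §3: stage-0 `ε`-regularity of affine forms at the GENERIC point (proved)

Theorem-only companion (cell `val-lit`, np lane, DDS21 Thm 3.2 programme "M-b", lead-np RULING
(148)(b); architecture of record `(A′)`, note `HOME/np/NOTE-t21g13-DDS21-B4c-generic-point.md`)
for P. Dutta, P. Dwivedi, N. Saxena, *Demystifying the border of depth-3 algebraic circuits*,
FOCS 2021 [DuttaDwivediSaxena2022], held full version `paper:galaxy-pdf-7641649743695546420`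
(chunk `pNNNN.txt`, printed line `Lnnn`).

## What is proved (no definitions, no named facts)

The printed proof of Thm. 3.2 begins by shifting with a RANDOM point: "`Φ : x_i ↦ z·x_i + α_i`
where `α_i` are random elements in `F`. Essentially, it suffices to ensure that
`Φ(T_{i,0})|_{x=0} = T_{i,0}(α) ≠ 0` for all `i ∈ [k]`" (p0028 L751–754). The tree's `ε`-side
bricks consume this in the STRENGTHENED form recorded in `DDS21DiDILEndGame.lean` §1
(`exists_regularModel_prod_affine`, hypothesis `ha`): every affine form `ℓ` of the shifted
stage-0 representation is `ε`-REGULAR,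

  `∃ c b, c ≠ 0 ∧ (∀ o, ℓ o = c · ι(b o)) ∧ (b none).coeff 0 ≠ 0`
  (`ι : F[ε] → F(ε)`; the constant term of the normalised form is an `ε`-adic unit).

Under `(A′)` the random point is the tuple of indeterminates `y` of `F′ = F(y) = Frac F[y]`, and
this file PROVES that every NONZERO affine form over `F(ε)`, base-changed to `F′(ε)`
(`DDS2021.ratFuncMap`, `DDS21BorderBaseChange.lean`) and shifted by `y`
(`x ↦ x + y`: new constant term `ℓ₀ + ∑_m ℓ_m y_m`, same linear part — the `z`-constant term of
`Φ(ℓ)`, cf. `aeval_phi_affine` in `DDS21TopFaninTwoDiDIL.lean`), is `ε`-regular in exactly that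
shape:

* §1 `exists_regular_of_shift` — for ANY field map `φ : F → F′` and any point `y ∈ F′ⁿ` that is
  AFFINELY FREE over `F` (`φ c₀ + ∑ φ c_m · y_m = 0 ⇒ c = 0`): write the coefficient vector as
  `c · ι(p)` with some `p_{o₀}(0) ≠ 0` (the tree's `exists_normalize_family`); then the shifted
  base change is `ratFuncMap φ c · ι(b)` with `b_m = p_m^φ`, `b₀ = p₀^φ + ∑_m y_m · p_m^φ`, and
  `b₀(0) = φ p₀(0) + ∑_m φ p_m(0) · y_m ≠ 0` by freeness. The shifted vector `a′` enters through
  CHARACTERISING HYPOTHESES (`hnone`, `hsome`), so a consumer's own expression for the shifted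
  forms matches by `rfl`/`simp`.
* §2 `generic_point_affinely_free` — `1, y₁, …, y_n` are affinely free over `F` in any fraction
  field `F′` of `F[y_τ]` (`y_m := y_{e m}` for an injection `e : Fin n ↪ τ`): a degree-`≤ 1`
  polynomial with those coefficients vanishes only if all coefficients do.
* §3 ★ `exists_regular_of_generic_shift` (one form), ★ `forall_exists_regular_of_generic_shift`
  (a family `a : Fin D → …` of nonzero forms — LITERALLY the hypothesis `ha` of
  `exists_regularModel_prod_affine` over `F′`), and the `FractionRing (MvPolynomial τ F)`
  specialisations `…_fractionRing`.
* §4 `bind₁_shift_affForm` — the polynomial identity `ℓ(x + y) = (ℓ₀ + ∑ ℓ_m y_m) + ∑ ℓ_m x_m`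
  (any commutative ring), so the stage-0 glue can rewrite its shifted forms into the shape of §1.

Typed vs printed: print asks only `T_{i,0}(α) ≠ 0`, i.e. `ℓ(α) ≠ 0` for every form of every
product, for a random `α ∈ Fⁿ`; the tree's `ε`-side needs the `ε`-ORDER of `ℓ(x + α)` to sit in
the constant term (note `HOME/np/NOTE-t19g11-DDS21-B4-eps-side.md` §1(b)), which for a random
`α` holds outside finitely many hypersurfaces and at the GENERIC point holds identically — that
is what is proved here. Forms that are identically `0` are excluded (`a ≠ 0`); a zero form makes
its product term vanish and is removed upstream. Honest framing: elementary `ε`-adic bookkeeping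
for a published 2021 theorem; `DDS2021_thm_3_2` remains an OPEN named fact; VP ≠ VNP is NOT
proved and nothing here bears on it.

## References

* [DuttaDwivediSaxena2022] P. Dutta, P. Dwivedi, N. Saxena, *Demystifying the border of depth-3
  algebraic circuits*, Proc. 62nd FOCS (2021), IEEE 2022, 92–103; full version: §2 "Valuation"
  p0015 L407–410 and "Field" (characteristic `0`); Def. 3.1 p0026 L702–707; the map `Φ` and the
  random point p0028 L751–754; Claim 3.3 proof p0027 L729–737.
-/

open MvPolynomial
open scoped BigOperators Polynomial

namespace Literature.Computability.AlgebraicComplexity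

namespace DDS2021

/-! ## §1 Regularity of the shifted base change at an affinely free point -/

section Shift

variable {F F' : Type*} [Field F] [Field F'] (φ : F →+* F') {n : ℕ}

/-- **`ε`-regularity of a shifted affine form.** Let `φ : F → F′` be a field map and
`y ∈ F′ⁿ` affinely free over `F`. For a NONZERO coefficient vector `a` of an affine form over
`F(ε)` let `a′` be the coefficient vector of the base-changed form shifted by `y`
(`a′₀ = a₀^φ + ∑_m a_m^φ · y_m`, `a′_m = a_m^φ`). Then `a′ = c · ι(b)` with `c ≠ 0`, `b` over
`F′[ε]` and `b₀(0) ≠ 0` — the `ε`-adic order of the shifted form sits in its constant term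
("it suffices to ensure that `Φ(T_{i,0})|_{x=0} = T_{i,0}(α) ≠ 0`", here at a generic `α`).
[cite: DuttaDwivediSaxena2022, §3 proof of Thm. 3.2, the map `Φ` (full version p0028 L751–754); §2 "Valuation" (p0015 L407–410)] -/
theorem exists_regular_of_shift (y : Fin n → F')
    (hy : ∀ c : Option (Fin n) → F, φ (c none) + ∑ m, φ (c (some m)) * y m = 0 → c = 0)
    {a : Option (Fin n) → RatFunc F} (ha : a ≠ 0) {a' : Option (Fin n) → RatFunc F'}
    (hnone : a' none = ratFuncMap φ (a none) +
      ∑ m, ratFuncMap φ (a (some m)) * algebraMap F' (RatFunc F') (y m))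
    (hsome : ∀ m, a' (some m) = ratFuncMap φ (a (some m))) :
    ∃ (c : RatFunc F') (b : Option (Fin n) → F'[X]), c ≠ 0 ∧
      (∀ o, a' o = c * algebraMap F'[X] (RatFunc F') (b o)) ∧ (b none).coeff 0 ≠ 0 := by
  classical
  obtain ⟨c, p, hc, hap, o₀, ho₀⟩ := exists_normalize_family a ha
  have hmapC : ∀ m, algebraMap F' (RatFunc F') (y m) =
      algebraMap F'[X] (RatFunc F') (Polynomial.C (y m)) := fun m => by
    rw [RatFunc.algebraMap_C, RatFunc.algebraMap_eq_C]
  refine ⟨ratFuncMap φ c,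
    fun o => o.elim ((p none).map φ + ∑ m, Polynomial.C (y m) * (p (some m)).map φ)
      (fun m => (p (some m)).map φ), (map_ne_zero (ratFuncMap φ)).mpr hc, ?_, ?_⟩
  · rintro (_ | m)
    · show a' none = ratFuncMap φ c * algebraMap F'[X] (RatFunc F')
        ((p none).map φ + ∑ m, Polynomial.C (y m) * (p (some m)).map φ)
      rw [hnone, hap none, map_mul, ratFuncMap_algebraMap, map_add, map_sum, mul_add,
        Finset.mul_sum]
      refine congrArg _ (Finset.sum_congr rfl fun m _ => ?_)
      rw [hap (some m), map_mul, ratFuncMap_algebraMap, map_mul, hmapC]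
      ring
    · show a' (some m) = ratFuncMap φ c * algebraMap F'[X] (RatFunc F') ((p (some m)).map φ)
      rw [hsome, hap (some m), map_mul, ratFuncMap_algebraMap]
  · show ((p none).map φ + ∑ m, Polynomial.C (y m) * (p (some m)).map φ).coeff 0 ≠ 0
    rw [Polynomial.coeff_add, Polynomial.coeff_map, Polynomial.finsetSum_coeff]
    simp only [Polynomial.coeff_C_mul, Polynomial.coeff_map]
    intro h0
    have hsum : φ ((p none).coeff 0) + ∑ m, φ ((p (some m)).coeff 0) * y m = 0 := by
      rw [← h0]
      exact congrArg _ (Finset.sum_congr rfl fun m _ => mul_comm _ _)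
    have h := congr_fun (hy (fun o => (p o).coeff 0) hsum) o₀
    exact ho₀ h

/-- Family form of `exists_regular_of_shift`: for `D` nonzero affine forms the shifted base
changes are all `ε`-regular — literally the hypothesis `ha` of `exists_regularModel_prod_affine`
(`DDS21DiDILEndGame.lean`) over `F′`.
[cite: DuttaDwivediSaxena2022, §3 proof of Thm. 3.2, the map `Φ` (full version p0028 L751–754)] -/
theorem forall_exists_regular_of_shift (y : Fin n → F')
    (hy : ∀ c : Option (Fin n) → F, φ (c none) + ∑ m, φ (c (some m)) * y m = 0 → c = 0)
    {D : ℕ} {a : Fin D → Option (Fin n) → RatFunc F} (ha : ∀ j, a j ≠ 0)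
    {a' : Fin D → Option (Fin n) → RatFunc F'}
    (hnone : ∀ j, a' j none = ratFuncMap φ (a j none) +
      ∑ m, ratFuncMap φ (a j (some m)) * algebraMap F' (RatFunc F') (y m))
    (hsome : ∀ j m, a' j (some m) = ratFuncMap φ (a j (some m))) :
    ∀ j, ∃ (c : RatFunc F') (b : Option (Fin n) → F'[X]), c ≠ 0 ∧
      (∀ o, a' j o = c * algebraMap F'[X] (RatFunc F') (b o)) ∧ (b none).coeff 0 ≠ 0 :=
  fun j => exists_regular_of_shift φ y hy (ha j) (hnone j) (hsome j)

end Shift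

/-! ## §2 The generic point is affinely free -/

section GenericPoint

variable {F : Type*} [Field F] {n : ℕ} {τ : Type*} {F' : Type*} [CommRing F']
  [Algebra (MvPolynomial τ F) F'] [IsFractionRing (MvPolynomial τ F) F'] [Algebra F F']
  [IsScalarTower F (MvPolynomial τ F) F']

/-- The linear coefficient `c_{m₀}` of the affine form `c₀ + ∑_m c_m y_{e m}` in `F[y_τ]`
(`e` injective). (folklore) [cite: DuttaDwivediSaxena2022, Def. 3.1 (full version p0026 L702–707)] -/
theorem coeff_single_affForm_comp (e : Fin n → τ) (he : Function.Injective e)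
    (c : Option (Fin n) → F) (m₀ : Fin n) :
    coeff (Finsupp.single (e m₀) 1) (C (c none) + ∑ m, C (c (some m)) * X (e m) :
      MvPolynomial τ F) = c (some m₀) := by
  classical
  have h0 : (0 : τ →₀ ℕ) ≠ Finsupp.single (e m₀) 1 :=
    fun h => one_ne_zero (Finsupp.single_eq_zero.mp h.symm)
  rw [coeff_add, coeff_C, if_neg h0, zero_add, coeff_sum]
  simp_rw [C_mul_X_eq_monomial, coeff_monomial]
  rw [Finset.sum_eq_single m₀]
  · rw [if_pos rfl]
  · intro m _ hm
    rw [if_neg]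
    intro h
    exact hm (he ((Finsupp.single_left_inj one_ne_zero).mp h))
  · intro h
    exact absurd (Finset.mem_univ m₀) h

/-- The constant coefficient of `c₀ + ∑_m c_m y_{e m}` in `F[y_τ]` is `c₀`. (folklore)
[cite: DuttaDwivediSaxena2022, Def. 3.1 (full version p0026 L702–707)] -/
theorem coeff_zero_affForm_comp (e : Fin n → τ) (c : Option (Fin n) → F) :
    coeff 0 (C (c none) + ∑ m, C (c (some m)) * X (e m) : MvPolynomial τ F) = c none := by
  classical
  rw [coeff_add, coeff_C, if_pos rfl, coeff_sum, Finset.sum_eq_zero, add_zero]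
  intro m _
  rw [C_mul_X_eq_monomial, coeff_monomial, if_neg]
  exact fun h => one_ne_zero (Finsupp.single_eq_zero.mp h)

/-- **The generic point is affinely free**: in a fraction field `F′` of `F[y_τ]`, the elements
`1, y_{e 1}, …, y_{e n}` (`e` injective) satisfy no nontrivial affine relation with coefficients
from `F` — "`P(α) ≠ 0` for a random `α`" holds IDENTICALLY at the transcendental point.
[cite: DuttaDwivediSaxena2022, §3 proof of Thm. 3.2, "`α_i` are random elements in `F`" (full version p0028 L751–754)] -/
theorem generic_point_affinely_free (e : Fin n → τ) (he : Function.Injective e)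
    (c : Option (Fin n) → F)
    (h : algebraMap F F' (c none) +
      ∑ m, algebraMap F F' (c (some m)) * algebraMap (MvPolynomial τ F) F' (X (e m)) = 0) :
    c = 0 := by
  have hinj := IsFractionRing.injective (MvPolynomial τ F) F'
  have hP : (C (c none) + ∑ m, C (c (some m)) * X (e m) : MvPolynomial τ F) = 0 := by
    apply hinj
    rw [map_zero, map_add, map_sum, ← h, IsScalarTower.algebraMap_apply F (MvPolynomial τ F) F',
      MvPolynomial.algebraMap_eq]
    refine congrArg _ (Finset.sum_congr rfl fun m _ => ?_)
    rw [map_mul, IsScalarTower.algebraMap_apply F (MvPolynomial τ F) F',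
      MvPolynomial.algebraMap_eq]
  funext o
  rcases o with _ | m₀
  · rw [Pi.zero_apply, ← coeff_zero_affForm_comp e c, hP, coeff_zero]
  · rw [Pi.zero_apply, ← coeff_single_affForm_comp e he c m₀, hP, coeff_zero]

end GenericPoint

/-! ## §3 Stage-0 regularity over the generic point -/

section Generic

variable {F : Type*} [Field F] {n : ℕ} {τ : Type*} {F' : Type*} [Field F']
  [Algebra (MvPolynomial τ F) F'] [IsFractionRing (MvPolynomial τ F) F'] [Algebra F F']
  [IsScalarTower F (MvPolynomial τ F) F']

/-- ★ **Stage-0 `ε`-regularity over the generic point.** For an injection `e : Fin n ↪ τ`, a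
fraction field `F′` of `F[y_τ]`, and a NONZERO affine form `a` over `F(ε)`, the base change of
`a` to `F′(ε)` shifted by the generic point `(y_{e m})_m` is `ε`-regular:
`a′ = c · ι(b)`, `c ≠ 0`, `b₀(0) ≠ 0` (the shape `ha` of `exists_regularModel_prod_affine`).
The shifted vector `a′` is given by the characterising hypotheses `hnone`/`hsome`.
[cite: DuttaDwivediSaxena2022, §3 proof of Thm. 3.2, the map `Φ` and the random point (full version p0028 L751–754)] -/
theorem exists_regular_of_generic_shift (e : Fin n → τ) (he : Function.Injective e)
    {a : Option (Fin n) → RatFunc F} (ha : a ≠ 0) {a' : Option (Fin n) → RatFunc F'}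
    (hnone : a' none = ratFuncMap (algebraMap F F') (a none) +
      ∑ m, ratFuncMap (algebraMap F F') (a (some m)) *
        algebraMap F' (RatFunc F') (algebraMap (MvPolynomial τ F) F' (X (e m))))
    (hsome : ∀ m, a' (some m) = ratFuncMap (algebraMap F F') (a (some m))) :
    ∃ (c : RatFunc F') (b : Option (Fin n) → F'[X]), c ≠ 0 ∧
      (∀ o, a' o = c * algebraMap F'[X] (RatFunc F') (b o)) ∧ (b none).coeff 0 ≠ 0 :=
  exists_regular_of_shift (algebraMap F F') (fun m => algebraMap (MvPolynomial τ F) F' (X (e m)))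
    (fun c hc => generic_point_affinely_free e he c hc) ha hnone hsome

/-- ★ **Family form** — for `D` nonzero affine forms over `F(ε)`, the shifted base changes over
the generic point are ALL `ε`-regular: literally the hypothesis `ha` of
`exists_regularModel_prod_affine` (`DDS21DiDILEndGame.lean` §1) over `F′ ⊇ F(y)`.
[cite: DuttaDwivediSaxena2022, §3 proof of Thm. 3.2, "it suffices to ensure that `Φ(T_{i,0})|_{x=0} = T_{i,0}(α) ≠ 0` for all `i`" (full version p0028 L751–754)] -/
theorem forall_exists_regular_of_generic_shift (e : Fin n → τ) (he : Function.Injective e)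
    {D : ℕ} {a : Fin D → Option (Fin n) → RatFunc F} (ha : ∀ j, a j ≠ 0)
    {a' : Fin D → Option (Fin n) → RatFunc F'}
    (hnone : ∀ j, a' j none = ratFuncMap (algebraMap F F') (a j none) +
      ∑ m, ratFuncMap (algebraMap F F') (a j (some m)) *
        algebraMap F' (RatFunc F') (algebraMap (MvPolynomial τ F) F' (X (e m))))
    (hsome : ∀ j m, a' j (some m) = ratFuncMap (algebraMap F F') (a j (some m))) :
    ∀ j, ∃ (c : RatFunc F') (b : Option (Fin n) → F'[X]), c ≠ 0 ∧
      (∀ o, a' j o = c * algebraMap F'[X] (RatFunc F') (b o)) ∧ (b none).coeff 0 ≠ 0 :=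
  fun j => exists_regular_of_generic_shift e he (ha j) (hnone j) (hsome j)

end Generic

/-! ### The `FractionRing (MvPolynomial (Fin n) F)` specialisation (the `(A′)` field `F(y)`) -/

section FractionRingInst

variable {F : Type*} [Field F] {n : ℕ}

/-- ★★ **Stage-0 `ε`-regularity over `F′ = Frac F[y₁,…,y_n]`, shift `x_m ↦ x_m + y_m`** (the
`(A′)` field and point of the tree's rendering of Thm. 3.2): every nonzero affine form over
`F(ε)` becomes `ε`-regular after base change to `F′(ε)` and the generic shift.
[cite: DuttaDwivediSaxena2022, §3 proof of Thm. 3.2, the map `Φ` and the random point (full version p0028 L751–754)] -/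
theorem exists_regular_of_generic_shift_fractionRing
    {a : Option (Fin n) → RatFunc F} (ha : a ≠ 0)
    {a' : Option (Fin n) → RatFunc (FractionRing (MvPolynomial (Fin n) F))}
    (hnone : a' none =
      ratFuncMap (algebraMap F (FractionRing (MvPolynomial (Fin n) F))) (a none) +
      ∑ m, ratFuncMap (algebraMap F (FractionRing (MvPolynomial (Fin n) F))) (a (some m)) *
        algebraMap (FractionRing (MvPolynomial (Fin n) F))
          (RatFunc (FractionRing (MvPolynomial (Fin n) F)))
          (algebraMap (MvPolynomial (Fin n) F) (FractionRing (MvPolynomial (Fin n) F)) (X m)))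
    (hsome : ∀ m, a' (some m) =
      ratFuncMap (algebraMap F (FractionRing (MvPolynomial (Fin n) F))) (a (some m))) :
    ∃ (c : RatFunc (FractionRing (MvPolynomial (Fin n) F)))
      (b : Option (Fin n) → (FractionRing (MvPolynomial (Fin n) F))[X]), c ≠ 0 ∧
      (∀ o, a' o = c * algebraMap _ (RatFunc (FractionRing (MvPolynomial (Fin n) F))) (b o)) ∧
      (b none).coeff 0 ≠ 0 :=
  exists_regular_of_generic_shift (F' := FractionRing (MvPolynomial (Fin n) F)) id
    Function.injective_id ha hnone hsome

/-- ★★ Family form over `F′ = Frac F[y₁,…,y_n]`: the hypothesis `ha` of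
`exists_regularModel_prod_affine` for the shifted base change of `D` nonzero forms.
[cite: DuttaDwivediSaxena2022, §3 proof of Thm. 3.2, the map `Φ` and the random point (full version p0028 L751–754)] -/
theorem forall_exists_regular_of_generic_shift_fractionRing {D : ℕ}
    {a : Fin D → Option (Fin n) → RatFunc F} (ha : ∀ j, a j ≠ 0)
    {a' : Fin D → Option (Fin n) → RatFunc (FractionRing (MvPolynomial (Fin n) F))}
    (hnone : ∀ j, a' j none =
      ratFuncMap (algebraMap F (FractionRing (MvPolynomial (Fin n) F))) (a j none) +
      ∑ m, ratFuncMap (algebraMap F (FractionRing (MvPolynomial (Fin n) F))) (a j (some m)) *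
        algebraMap (FractionRing (MvPolynomial (Fin n) F))
          (RatFunc (FractionRing (MvPolynomial (Fin n) F)))
          (algebraMap (MvPolynomial (Fin n) F) (FractionRing (MvPolynomial (Fin n) F)) (X m)))
    (hsome : ∀ j m, a' j (some m) =
      ratFuncMap (algebraMap F (FractionRing (MvPolynomial (Fin n) F))) (a j (some m))) :
    ∀ j, ∃ (c : RatFunc (FractionRing (MvPolynomial (Fin n) F)))
      (b : Option (Fin n) → (FractionRing (MvPolynomial (Fin n) F))[X]), c ≠ 0 ∧
      (∀ o, a' j o = c * algebraMap _ (RatFunc (FractionRing (MvPolynomial (Fin n) F))) (b o)) ∧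
      (b none).coeff 0 ≠ 0 :=
  fun j => exists_regular_of_generic_shift_fractionRing (ha j) (hnone j) (hsome j)

end FractionRingInst

/-! ## §4 The shift of an affine form (polynomial identity) -/

section ShiftIdentity

variable {R : Type*} [CommRing R] {n : ℕ}

/-- `ℓ(x + y) = (ℓ₀ + ∑_m ℓ_m y_m) + ∑_m ℓ_m x_m`: shifting an affine form by the point `y`
changes only its constant term, to the VALUE `ℓ(y)`. (folklore)
[cite: DuttaDwivediSaxena2022, §3 proof of Thm. 3.2, the map `Φ` (full version p0028 L751–754)] -/
theorem bind₁_shift_affForm (y : Fin n → R) (a : Option (Fin n) → R) :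
    bind₁ (fun m => X m + C (y m)) (C (a none) + ∑ m, C (a (some m)) * X m) =
      C (a none + ∑ m, a (some m) * y m) + ∑ m, C (a (some m)) * X m := by
  simp only [map_add, map_sum, map_mul, bind₁_C_right, bind₁_X_right, mul_add]
  rw [add_assoc, ← Finset.sum_add_distrib]
  refine congrArg _ (Finset.sum_congr rfl fun m _ => by ring)

/-- Base change then shift: `ℓ^ψ(x + y) = (ψ ℓ₀ + ∑_m ψ ℓ_m · y_m) + ∑_m ψ ℓ_m · x_m` for a ring
map `ψ` (with `ψ = ratFuncMap φ : F(ε) → F′(ε)` and `y_m ∈ F′ ⊂ F′(ε)` this is the vector `a′`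
of `exists_regular_of_shift`). (folklore)
[cite: DuttaDwivediSaxena2022, §3 proof of Thm. 3.2, the map `Φ` (full version p0028 L751–754)] -/
theorem bind₁_shift_map_affForm {K : Type*} [CommRing K] (ψ : K →+* R) (y : Fin n → R)
    (a : Option (Fin n) → K) :
    bind₁ (fun m => X m + C (y m)) (map ψ (C (a none) + ∑ m, C (a (some m)) * X m)) =
      C (ψ (a none) + ∑ m, ψ (a (some m)) * y m) + ∑ m, C (ψ (a (some m))) * X m := by
  have h : map ψ (C (a none) + ∑ m, C (a (some m)) * X m) =
      C (ψ (a none)) + ∑ m, C (ψ (a (some m))) * X m := by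
    simp only [map_add, map_sum, map_mul, map_C, map_X]
  rw [h]
  exact bind₁_shift_affForm y (fun o => ψ (a o))

end ShiftIdentity

end DDS2021

end Literature.Computability.AlgebraicComplexity
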